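import Summits.QuantumFields.BalabanUV.Beta.GAN24.FaceWordBondPush
import Summits.QuantumFields.BalabanUV.Beta.GAN24.JointPeriodicCellSwap

/-!
# `BalabanUV.Beta.GAN24.FaceWordsDeepCurrents` — binder row G-an2-4 ∕ (CONV-C), W-slot (α-0), ROW (C)sym AT LEVELS `≥ 1` (rows T6-STEP of the OWNER's
# two-index tower, RULING R-gan24p1-g40-1): **THE TWO EXCHANGE FACE WORDS OF THE DRESSED VERTICES AT THE COARSE BONDS ARE `K²` TIMES THE EXCHANGE FACE
# WORDS OF THE FINE TABLES AT THE DEEP PERIOD** — Part 45 of `GAN24/FourFaceGaugeSectors` (G-an2-4 CRUX TEAM (2), leaf prover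
# `b2b-balaban-gan24-formalise-leaf-02`, gen 69; journal [LEAF02-G69-STAGED1] «NEXT»)

NOT IN PRINT; OUR BOOKKEEPING ([folklore] bookkeeping BY NAME over Part 45a `FaceWordBondPush` (the two pushes through the face pairing), leaf-06 K4a
`JointPeriodicCellSwap.sum_box_tsum_swap_weight` (cell slot ↔ free slot of a jointly periodic two-slot sum), an2's `biLoc_comp_biLoc ∕ comp_shiftK`;
0 `def`, 0 cited fact, 0 `def … : Prop`, 0 sorry).  HONEST FRAMING (cell contract, verbatim): «discharging `BetaPertH` makes Bałaban's UV stability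
UNCONDITIONAL — a real constructive-QFT result; it is NOT the continuum limit and NOT the Clay problem.»  HONEST DEPENDENCY (verbatim): «continuum YM on T⁴ ⇐
BetaPertH ∧ nine spine estimates (0/9 proved); BetaPertH ⇐ (D1) ∧ (D4) ∧ CAP+tail; G-an2-4 gates asym, D1 and NE2/3/4.»

WHAT (generic `d`; `1 ≤ Lc`; coarse period `P ≥ 1`, deep period `N ≥ 1` (`N = Lc·P` at the use site); a decaying `N`-block covariant kernel `X` (road-P2's
`X̃♮_j = unitK … (coDressKBmAt ρ Lc (KInvStep Lc j))`); a COARSE bond family `D κ u` (the dressed vertices `dM X̃ Lc S̃ M̃ κ u` of leaf-06 K6c's words) uniformly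
bi-localised at `Lc•u` and `(P, N)`-covariant (`D κ (u + P•s) = shiftK (−N•s) (D κ u)`, `SecondOrderResponse.dM_translate`); a FINE local stencil family `S`
(`LocStencil S Cs δ`, `N`-covariant); bounded bond weights `w κ` (`P`-periodic) ∕ `w′ κ` (`N`-periodic) and a bounded `N`-periodic leg weight `m`; the ENTRYWISE
push law `hpush : Σ'_u w κ u·D κ u = K·Σ'_t w′ κ t·S κ t` (leaf-06 K1a `DressedVertexFaceBondSum.tsum_faceBond_vertexOfK_dressedStep` with the exit-face indicators
`w κ u = [u_κ % P = P−1]`, `w′ κ t = [t_κ % (Lc·P) = Lc·P−1]`, the multiplier vertex dying by road-P2's `tsum_coord_colM`)):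
* §1 tools: `biLoc_triple_pts`, `abs_tsum_weightPair_le`, `tsum_weightPair_shiftK`, `mixed_translate`, and the two slot summabilities of a cell word;
* §2 **`faceWord_direct_eq`**: `Σ_{r′∈box P} Σ'_{u′} w μ r′·w ν u′·Σ'_{(y,w)} m·((D μ r′ ∘ X) ∘ D ν u′)(y,w)(a,b) = K·K·Σ_{rr∈box N} Σ'_t w′ μ rr·w′ ν t·Σ'_{(y,w)} m·((S μ rr ∘ X) ∘ S ν t)(y,w)(a,b)`;
* §3 **`faceWord_swap_eq`**: the same for the swapped word `(D ν u′ ∘ X) ∘ D μ r′ ↦ (S ν t ∘ X) ∘ S μ rr`.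
With the exit-face indicators these right sides are `K²·EE₁` ∕ `K²·EE₂` of Part 44 `FacePairingPairForm.eeWords_eq_pairForm` at the deep period `N`.  Asserts NO value of any
table; discharges NOTHING of (C)_{≥1} ∕ `hstep` ∕ `hSrc` ∕ `hSrcX` ∕ (Q-L) ∕ (hW, hWall); NEVER «G-an2-4 closed» as (CONV-C); NOT D1, NOT `BetaPertH`, NOT continuum, NOT Clay.
2026-08-24; no existing file touched.
-/

noncomputable section

open Finset
open scoped BigOperators
open Literature.MathematicalPhysics.QuantumFieldTheory
open Literature.MathematicalPhysics.QuantumFieldTheory.Balaban1983to89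
open Literature.MathematicalPhysics.QuantumFieldTheory.Balaban1983to89.Beta
open B12Sec2to5 (l1 l1_nonneg)
open ExpKernelCalculus (Site MKer Decays BiLoc shiftK comp comp_shiftK biLoc_comp_biLoc l1_sub_symm Zl Zl_pos Zl_nonneg summable_exp_shift
  summable_exp_shift' tsum_exp_shift')
open OneStepResolventKernel (Fib LocStencil biLoc_mono)
open AffineAveraging (box toSite)
open BalabanStepJetsSucc (biLoc_comp_right)
open Summit.QuantumFields.BalabanUV.Beta.GAN24.JointPeriodicCellSwap (sum_box_tsum_swap_weight)
open Summit.QuantumFields.BalabanUV.Beta.GAN24.FaceWordBondPush (push_right_facePair push_left_facePair)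

namespace Summit.QuantumFields.BalabanUV.Beta.GAN24.FaceWordsDeepCurrents

variable {d : ℕ}

/-! ## §1 Tools: the triple word between two bond-localised factors, weighted leg pairs, covariance -/

section Tools

variable {X Dl Er T : MKer (d + 1) (Fib d)} {v s p q : Site (d + 1)} {CX C₁ C₂ C δ : ℝ}

/-- [folklore] **THE TRIPLE WORD BETWEEN TWO BOND-LOCALISED FACTORS** `Dl ∘ X ∘ Er` (`Dl` at `(v,v)`, `Er` at `(s,s)`, `X` decaying, common rate `δ > 0`) is bi-localised
at `(v, s)` at rate `δ/2` with the inner-distance factor `e^{−(δ/4)|v − s|₁}` (Part 43 `biLoc_tripleWord`, generic factors). -/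
theorem biLoc_triple_pts (hDl : BiLoc Dl v v C₁ δ) (hX : Decays X CX δ) (hEr : BiLoc Er s s C₂ δ) (hδ : 0 < δ) :
    BiLoc (comp (comp Dl X) Er) v s
      ((Fintype.card (Fib d) : ℝ) * ((Fintype.card (Fib d) : ℝ) * (C₁ * CX) * Zl (d + 1) (δ - δ / 2) * C₂) * Zl (d + 1) (δ / 2 / 2)
        * Real.exp (-(δ / 2 / 2) * l1 (v - s))) (δ / 2) := by
  have hC₂ : 0 ≤ C₂ := hEr.nonneg (Sum.inl 0)
  have h1 : BiLoc (comp Dl X) v v ((Fintype.card (Fib d) : ℝ) * (C₁ * CX) * Zl (d + 1) (δ - δ / 2)) (δ / 2) :=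
    biLoc_comp_right hDl hX (by positivity) (by linarith)
  have h2 : BiLoc Er s s C₂ (δ / 2) := biLoc_mono hEr hC₂ (by linarith)
  exact biLoc_comp_biLoc h1 h2 (by positivity)

/-- [folklore] A bounded-weight leg pair sum of a bi-localised kernel is absolutely bounded by `C·Zl(δ)²` (Part 42 `abs_tsum_facePair_le`, generic weight). -/
theorem abs_tsum_weightPair_le (hT : BiLoc T p q C δ) (hδ : 0 < δ) (m : Site (d + 1) × Site (d + 1) → ℝ) (hm : ∀ yw, |m yw| ≤ 1) (a b : Fib d) :
    |∑' yw : Site (d + 1) × Site (d + 1), m yw * T yw.1 yw.2 a b| ≤ C * (Zl (d + 1) δ * Zl (d + 1) δ) := by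
  have h1 : Summable fun y : Site (d + 1) => Real.exp (-δ * l1 (y - p)) := summable_exp_shift' hδ p
  have h2 : Summable fun w : Site (d + 1) => Real.exp (-δ * l1 (w - q)) := summable_exp_shift' hδ q
  have hprod : Summable fun yw : Site (d + 1) × Site (d + 1) => Real.exp (-δ * l1 (yw.1 - p)) * Real.exp (-δ * l1 (yw.2 - q)) :=
    h1.mul_of_nonneg h2 (fun _ => (Real.exp_pos _).le) (fun _ => (Real.exp_pos _).le)
  have hb := tsum_of_norm_bounded (hprod.mul_left C).hasSum (fun yw => by
    rw [Real.norm_eq_abs, abs_mul]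
    have hk := hT yw.1 yw.2 a b
    have h0 : 0 ≤ C * Real.exp (-δ * (l1 (yw.1 - p) + l1 (yw.2 - q))) := (abs_nonneg _).trans hk
    calc |m yw| * |T yw.1 yw.2 a b| ≤ 1 * (C * Real.exp (-δ * (l1 (yw.1 - p) + l1 (yw.2 - q)))) := mul_le_mul (hm yw) hk (abs_nonneg _) zero_le_one
      _ = C * (Real.exp (-δ * l1 (yw.1 - p)) * Real.exp (-δ * l1 (yw.2 - q))) := by rw [one_mul, mul_add, Real.exp_add])
  rw [Real.norm_eq_abs] at hb
  refine hb.trans (le_of_eq ?_)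
  have hn1 : Summable fun y : Site (d + 1) => ‖Real.exp (-δ * l1 (y - p))‖ := h1.congr fun y => by rw [Real.norm_eq_abs, abs_of_pos (Real.exp_pos _)]
  have hn2 : Summable fun w : Site (d + 1) => ‖Real.exp (-δ * l1 (w - q))‖ := h2.congr fun w => by rw [Real.norm_eq_abs, abs_of_pos (Real.exp_pos _)]
  rw [tsum_mul_left, ← tsum_mul_tsum_of_summable_norm hn1 hn2, tsum_exp_shift', tsum_exp_shift']

/-- [folklore] A periodic-weight leg pair sum is invariant under the simultaneous translation of the kernel (`m (y+v, w+v) = m (y, w)`; re-index the pair). -/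
theorem tsum_weightPair_shiftK (m : Site (d + 1) × Site (d + 1) → ℝ) (v : Site (d + 1)) (hmv : ∀ y w, m (y + v, w + v) = m (y, w))
    (T : MKer (d + 1) (Fib d)) (a b : Fib d) :
    ∑' yw : Site (d + 1) × Site (d + 1), m yw * shiftK v T yw.1 yw.2 a b = ∑' yw : Site (d + 1) × Site (d + 1), m yw * T yw.1 yw.2 a b := by
  rw [← (Equiv.prodCongr (Equiv.addRight v) (Equiv.addRight v)).tsum_eq (fun yw : Site (d + 1) × Site (d + 1) => m yw * T yw.1 yw.2 a b)]
  refine tsum_congr fun yw => ?_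
  show m yw * T (yw.1 + v) (yw.2 + v) a b = m (yw.1 + v, yw.2 + v) * T (yw.1 + v) (yw.2 + v) a b
  rw [hmv]

/-- [folklore] **MIXED COVARIANCE OF THE WORD**: a left factor covariant under `u ↦ u + P•s` with fine shift `N•s`, a right factor covariant under `t ↦ t + Q•s` with the
same fine shift, and an `N`-block covariant middle kernel give a jointly covariant triple word (`comp_shiftK` twice). -/
theorem mixed_translate {P Q N : ℕ} {DL DR : Site (d + 1) → MKer (d + 1) (Fib d)}
    (hL : ∀ u s, DL (u + (P : ℤ) • s) = shiftK (-((N : ℤ) • s)) (DL u)) (hR : ∀ t s, DR (t + (Q : ℤ) • s) = shiftK (-((N : ℤ) • s)) (DR t))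
    (hXt : ∀ s, shiftK (-((N : ℤ) • s)) X = X) (u t s : Site (d + 1)) :
    comp (comp (DL (u + (P : ℤ) • s)) X) (DR (t + (Q : ℤ) • s)) = shiftK (-((N : ℤ) • s)) (comp (comp (DL u) X) (DR t)) := by
  rw [hL u s, hR t s]
  conv_lhs => rw [← hXt s]
  rw [comp_shiftK, comp_shiftK]

end Tools

/-! ## §2 The direct word -/

section Words

variable {Lc P N : ℕ} [NeZero P] [NeZero N] {X : MKer (d + 1) (Fib d)} {D S : Fin (d + 1) → Site (d + 1) → MKer (d + 1) (Fib d)} {CX CD Cs δ : ℝ}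

/-- [folklore] **SUMMABILITY OF A CELL WORD IN ITS FREE FINE BOND**: for a left factor bi-localised at `v`, `t ↦ w t·Σ'_{(y,w′)} m·((Dl ∘ X) ∘ S ν t)(y,w′)(a,b)` is summable
(`|·| ≤ K₀·Zl²·e^{−(δ/4)|v − t|₁}`). -/
theorem summable_word_fine {Dl : MKer (d + 1) (Fib d)} {v : Site (d + 1)} {C₁ : ℝ} (hDl : BiLoc Dl v v C₁ δ) (hX : Decays X CX δ) (hδ : 0 < δ)
    (hS : LocStencil S Cs δ) (ν : Fin (d + 1)) (wt : Site (d + 1) → ℝ) (hwt : ∀ t, |wt t| ≤ 1)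
    (m : Site (d + 1) × Site (d + 1) → ℝ) (hm : ∀ yw, |m yw| ≤ 1) (a b : Fib d) :
    Summable fun t : Site (d + 1) => wt t * ∑' yw : Site (d + 1) × Site (d + 1), m yw * comp (comp Dl X) (S ν t) yw.1 yw.2 a b := by
  set K₀ : ℝ := (Fintype.card (Fib d) : ℝ) * ((Fintype.card (Fib d) : ℝ) * (C₁ * CX) * Zl (d + 1) (δ - δ / 2) * Cs) * Zl (d + 1) (δ / 2 / 2) with hK₀
  have hδ4 : 0 < δ / 2 / 2 := by positivity
  refine Summable.of_norm_bounded ((summable_exp_shift hδ4 v).mul_left (K₀ * (Zl (d + 1) (δ / 2) * Zl (d + 1) (δ / 2)))) (fun t => ?_)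
  rw [Real.norm_eq_abs, abs_mul]
  have hW := biLoc_triple_pts hDl hX (hS ν t) hδ
  have h := abs_tsum_weightPair_le hW (by positivity) m hm a b
  have h0 : 0 ≤ K₀ * Real.exp (-(δ / 2 / 2) * l1 (v - t)) * (Zl (d + 1) (δ / 2) * Zl (d + 1) (δ / 2)) := (abs_nonneg _).trans h
  calc |wt t| * _ ≤ 1 * (K₀ * Real.exp (-(δ / 2 / 2) * l1 (v - t)) * (Zl (d + 1) (δ / 2) * Zl (d + 1) (δ / 2))) :=
        mul_le_mul (hwt t) h (abs_nonneg _) zero_le_one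
    _ = K₀ * (Zl (d + 1) (δ / 2) * Zl (d + 1) (δ / 2)) * Real.exp (-(δ / 2 / 2) * l1 (v - t)) := by ring

/-- [folklore] **SUMMABILITY OF A CELL WORD IN ITS FREE COARSE BOND**: for a right factor bi-localised at `s` and the coarse family `D μ u` at `Lc•u`,
`u ↦ w u·Σ'_{(y,w′)} m·((D μ u ∘ X) ∘ Er)(y,w′)(a,b)` is summable (`KernelLegCharges.summable_exp_coarse`). -/
theorem summable_word_coarse (hLc : 1 ≤ Lc) {Er : MKer (d + 1) (Fib d)} {s : Site (d + 1)} {C₂ : ℝ} (hEr : BiLoc Er s s C₂ δ) (hX : Decays X CX δ) (hδ : 0 < δ)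
    (hD : ∀ κ u, BiLoc (D κ u) ((Lc : ℤ) • u) ((Lc : ℤ) • u) CD δ) (μ : Fin (d + 1)) (wu : Site (d + 1) → ℝ) (hwu : ∀ u, |wu u| ≤ 1)
    (m : Site (d + 1) × Site (d + 1) → ℝ) (hm : ∀ yw, |m yw| ≤ 1) (a b : Fib d) :
    Summable fun u : Site (d + 1) => wu u * ∑' yw : Site (d + 1) × Site (d + 1), m yw * comp (comp (D μ u) X) Er yw.1 yw.2 a b := by
  set K₀ : ℝ := (Fintype.card (Fib d) : ℝ) * ((Fintype.card (Fib d) : ℝ) * (CD * CX) * Zl (d + 1) (δ - δ / 2) * C₂) * Zl (d + 1) (δ / 2 / 2) with hK₀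
  have hδ4 : 0 < δ / 2 / 2 := by positivity
  refine Summable.of_norm_bounded ((KernelLegCharges.summable_exp_coarse hLc hδ4 s).mul_left (K₀ * (Zl (d + 1) (δ / 2) * Zl (d + 1) (δ / 2))))
    (fun u => ?_)
  rw [Real.norm_eq_abs, abs_mul]
  have hW := biLoc_triple_pts (hD μ u) hX hEr hδ
  have h := abs_tsum_weightPair_le hW (by positivity) m hm a b
  calc |wu u| * _ ≤ 1 * (K₀ * Real.exp (-(δ / 2 / 2) * l1 ((Lc : ℤ) • u - s)) * (Zl (d + 1) (δ / 2) * Zl (d + 1) (δ / 2))) :=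
        mul_le_mul (hwu u) h (abs_nonneg _) zero_le_one
    _ = K₀ * (Zl (d + 1) (δ / 2) * Zl (d + 1) (δ / 2)) * Real.exp (-(δ / 2 / 2) * l1 ((Lc : ℤ) • u - s)) := by ring

/-- [folklore] The same for a right fine factor `S ν t` and the free FINE left bond: `t′ ↦ w t′·Σ' m·((S μ t′ ∘ X) ∘ Er)` is summable. -/
theorem summable_word_fine_left {Er : MKer (d + 1) (Fib d)} {s : Site (d + 1)} {C₂ : ℝ} (hEr : BiLoc Er s s C₂ δ) (hX : Decays X CX δ) (hδ : 0 < δ)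
    (hS : LocStencil S Cs δ) (μ : Fin (d + 1)) (wt : Site (d + 1) → ℝ) (hwt : ∀ t, |wt t| ≤ 1)
    (m : Site (d + 1) × Site (d + 1) → ℝ) (hm : ∀ yw, |m yw| ≤ 1) (a b : Fib d) :
    Summable fun t : Site (d + 1) => wt t * ∑' yw : Site (d + 1) × Site (d + 1), m yw * comp (comp (S μ t) X) Er yw.1 yw.2 a b := by
  set K₀ : ℝ := (Fintype.card (Fib d) : ℝ) * ((Fintype.card (Fib d) : ℝ) * (Cs * CX) * Zl (d + 1) (δ - δ / 2) * C₂) * Zl (d + 1) (δ / 2 / 2) with hK₀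
  have hδ4 : 0 < δ / 2 / 2 := by positivity
  refine Summable.of_norm_bounded ((summable_exp_shift' hδ4 s).mul_left (K₀ * (Zl (d + 1) (δ / 2) * Zl (d + 1) (δ / 2)))) (fun t => ?_)
  rw [Real.norm_eq_abs, abs_mul]
  have hW := biLoc_triple_pts (hS μ t) hX hEr hδ
  have h := abs_tsum_weightPair_le hW (by positivity) m hm a b
  calc |wt t| * _ ≤ 1 * (K₀ * Real.exp (-(δ / 2 / 2) * l1 (t - s)) * (Zl (d + 1) (δ / 2) * Zl (d + 1) (δ / 2))) :=
        mul_le_mul (hwt t) h (abs_nonneg _) zero_le_one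
    _ = K₀ * (Zl (d + 1) (δ / 2) * Zl (d + 1) (δ / 2)) * Real.exp (-(δ / 2 / 2) * l1 (t - s)) := by ring

/-- [folklore] The same for a left coarse factor `D ν u′` (fixed) and the free COARSE right bond `u`: `u ↦ w u·Σ' m·((Dl ∘ X) ∘ D μ u)` is summable. -/
theorem summable_word_coarse_right (hLc : 1 ≤ Lc) {Dl : MKer (d + 1) (Fib d)} {v : Site (d + 1)} {C₁ : ℝ} (hDl : BiLoc Dl v v C₁ δ) (hX : Decays X CX δ)
    (hδ : 0 < δ) (hD : ∀ κ u, BiLoc (D κ u) ((Lc : ℤ) • u) ((Lc : ℤ) • u) CD δ) (μ : Fin (d + 1)) (wu : Site (d + 1) → ℝ) (hwu : ∀ u, |wu u| ≤ 1)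
    (m : Site (d + 1) × Site (d + 1) → ℝ) (hm : ∀ yw, |m yw| ≤ 1) (a b : Fib d) :
    Summable fun u : Site (d + 1) => wu u * ∑' yw : Site (d + 1) × Site (d + 1), m yw * comp (comp Dl X) (D μ u) yw.1 yw.2 a b := by
  set K₀ : ℝ := (Fintype.card (Fib d) : ℝ) * ((Fintype.card (Fib d) : ℝ) * (C₁ * CX) * Zl (d + 1) (δ - δ / 2) * CD) * Zl (d + 1) (δ / 2 / 2) with hK₀
  have hδ4 : 0 < δ / 2 / 2 := by positivity
  have hsum : Summable fun u : Site (d + 1) => Real.exp (-(δ / 2 / 2) * l1 (v - (Lc : ℤ) • u)) :=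
    (KernelLegCharges.summable_exp_coarse hLc hδ4 v).congr fun u => by rw [l1_sub_symm]
  refine Summable.of_norm_bounded (hsum.mul_left (K₀ * (Zl (d + 1) (δ / 2) * Zl (d + 1) (δ / 2)))) (fun u => ?_)
  rw [Real.norm_eq_abs, abs_mul]
  have hW := biLoc_triple_pts hDl hX (hD μ u) hδ
  have h := abs_tsum_weightPair_le hW (by positivity) m hm a b
  calc |wu u| * _ ≤ 1 * (K₀ * Real.exp (-(δ / 2 / 2) * l1 (v - (Lc : ℤ) • u)) * (Zl (d + 1) (δ / 2) * Zl (d + 1) (δ / 2))) :=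
        mul_le_mul (hwu u) h (abs_nonneg _) zero_le_one
    _ = K₀ * (Zl (d + 1) (δ / 2) * Zl (d + 1) (δ / 2)) * Real.exp (-(δ / 2 / 2) * l1 (v - (Lc : ℤ) • u)) := by ring

/-- [folklore] Factoring the cell weight out of a cell word: `Σ_rr Σ'_t f rr·g t·T rr t = Σ_rr f rr·Σ'_t g t·T rr t`. -/
theorem sum_tsum_factor (f : (Fin (d + 1) → ℕ) → ℝ) (g : Site (d + 1) → ℝ) (Tw : (Fin (d + 1) → ℕ) → Site (d + 1) → ℝ) (B : Finset (Fin (d + 1) → ℕ)) :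
    ∑ rr ∈ B, ∑' t : Site (d + 1), f rr * g t * Tw rr t = ∑ rr ∈ B, f rr * ∑' t : Site (d + 1), g t * Tw rr t := by
  refine Finset.sum_congr rfl fun rr _ => ?_
  rw [← tsum_mul_left]
  exact tsum_congr fun t => by ring

/-- NOT IN PRINT; OUR BOOKKEEPING.  **THE DIRECT EXCHANGE FACE WORD OF THE COARSE BOND FAMILY IS `K²` TIMES THE DEEP ONE** (module docstring; `D`, `S`, `X`, the
weights and `hpush` as there): `Σ_{r′∈box P} Σ'_{u′} w μ r′·w ν u′·Σ'_{(y,w)} m·((D μ r′ ∘ X) ∘ D ν u′)(y,w)(a,b) = K·K·Σ_{rr∈box N} Σ'_t w′ μ rr·w′ ν t·Σ'_{(y,w)} m·((S μ rr ∘ X) ∘ S ν t)(y,w)(a,b)`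
— push the free bond (Part 45a `push_right_facePair`), swap the cell onto the fine bond (K4a at periods `(P, N)`), push the freed coarse bond (`push_left_facePair`),
swap back (K4a at `(N, N)`). -/
theorem faceWord_direct_eq (hLc : 1 ≤ Lc) (hX : Decays X CX δ) (hXt : ∀ s : Site (d + 1), shiftK (-((N : ℤ) • s)) X = X) (hδ : 0 < δ)
    (hD : ∀ κ u, BiLoc (D κ u) ((Lc : ℤ) • u) ((Lc : ℤ) • u) CD δ)
    (hDt : ∀ (κ : Fin (d + 1)) (u s : Site (d + 1)), D κ (u + (P : ℤ) • s) = shiftK (-((N : ℤ) • s)) (D κ u))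
    (hS : LocStencil S Cs δ) (hSt : ∀ (κ : Fin (d + 1)) (t s : Site (d + 1)), S κ (t + (N : ℤ) • s) = shiftK (-((N : ℤ) • s)) (S κ t))
    (w w' : Fin (d + 1) → Site (d + 1) → ℝ) (hw : ∀ κ u, |w κ u| ≤ 1) (hw' : ∀ κ t, |w' κ t| ≤ 1)
    (hwP : ∀ (κ : Fin (d + 1)) (u s : Site (d + 1)), w κ (u + (P : ℤ) • s) = w κ u)
    (hw'N : ∀ (κ : Fin (d + 1)) (t s : Site (d + 1)), w' κ (t + (N : ℤ) • s) = w' κ t) (K : ℝ)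
    (hpush : ∀ (κ : Fin (d + 1)) (x z : Site (d + 1)) (a b : Fib d),
      ∑' u : Site (d + 1), w κ u * D κ u x z a b = K * ∑' t : Site (d + 1), w' κ t * S κ t x z a b)
    (m : Site (d + 1) × Site (d + 1) → ℝ) (hm : ∀ yw, |m yw| ≤ 1)
    (hmN : ∀ (y w₀ s : Site (d + 1)), m (y + (N : ℤ) • s, w₀ + (N : ℤ) • s) = m (y, w₀)) (μ ν : Fin (d + 1)) (a b : Fib d) :
    ∑ r' ∈ box (d + 1) P, ∑' u' : Site (d + 1), w μ (toSite r') * w ν u' *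
        ∑' yw : Site (d + 1) × Site (d + 1), m yw * comp (comp (D μ (toSite r')) X) (D ν u') yw.1 yw.2 a b
      = K * K * ∑ rr ∈ box (d + 1) N, ∑' t : Site (d + 1), w' μ (toSite rr) * w' ν t *
        ∑' yw : Site (d + 1) × Site (d + 1), m yw * comp (comp (S μ (toSite rr)) X) (S ν t) yw.1 yw.2 a b := by
  have hmv : ∀ (s y w₀ : Site (d + 1)), m (y + -((N : ℤ) • s), w₀ + -((N : ℤ) • s)) = m (y, w₀) := by
    intro s y w₀
    have h := hmN y w₀ (-s)
    rwa [smul_neg] at h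
  -- (A) push the free coarse bond `u′` in every cell term
  rw [sum_tsum_factor]
  have hA : ∀ r' : Fin (d + 1) → ℕ, ∑' u' : Site (d + 1), w ν u' * ∑' yw : Site (d + 1) × Site (d + 1), m yw * comp (comp (D μ (toSite r')) X) (D ν u') yw.1 yw.2 a b
      = K * ∑' t : Site (d + 1), w' ν t * ∑' yw : Site (d + 1) × Site (d + 1), m yw * comp (comp (D μ (toSite r')) X) (S ν t) yw.1 yw.2 a b :=
    fun r' => push_right_facePair hLc (hD μ (toSite r')) hX hδ hD hS ν (w ν) (hw ν) (w' ν) (hw' ν) K (hpush ν) m hm a b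
  simp_rw [hA]
  rw [show (∑ r' ∈ box (d + 1) P, w μ (toSite r') * (K * ∑' t : Site (d + 1), w' ν t *
      ∑' yw : Site (d + 1) × Site (d + 1), m yw * comp (comp (D μ (toSite r')) X) (S ν t) yw.1 yw.2 a b))
      = K * ∑ r' ∈ box (d + 1) P, w μ (toSite r') * ∑' t : Site (d + 1), w' ν t *
      ∑' yw : Site (d + 1) × Site (d + 1), m yw * comp (comp (D μ (toSite r')) X) (S ν t) yw.1 yw.2 a b by
    rw [Finset.mul_sum]; exact Finset.sum_congr rfl fun r' _ => by ring]
  -- (B) the cell restriction moves onto the fine bond: periods `(P, N)`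
  rw [sum_box_tsum_swap_weight (P := P) (Q := N)
      (fun u t => ∑' yw : Site (d + 1) × Site (d + 1), m yw * comp (comp (D μ u) X) (S ν t) yw.1 yw.2 a b) (w μ) (w' ν)
      (fun u t s => by
        show (∑' yw : Site (d + 1) × Site (d + 1), m yw * comp (comp (D μ (u + (P : ℤ) • s)) X) (S ν (t + (N : ℤ) • s)) yw.1 yw.2 a b) = _
        rw [mixed_translate (DL := D μ) (DR := S ν) (hDt μ) (hSt ν) hXt u t s, tsum_weightPair_shiftK m _ (hmv s)])
      (hwP μ) (hw'N ν)
      (fun u => summable_word_fine (hD μ u) hX hδ hS ν (w' ν) (hw' ν) m hm a b)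
      (fun t => summable_word_coarse hLc (hS ν t) hX hδ hD μ (w μ) (hw μ) m hm a b)]
  -- (C) push the freed coarse bond `u` in every cell term
  have hC : ∀ rr : Fin (d + 1) → ℕ, ∑' u : Site (d + 1), w μ u * ∑' yw : Site (d + 1) × Site (d + 1), m yw * comp (comp (D μ u) X) (S ν (toSite rr)) yw.1 yw.2 a b
      = K * ∑' t' : Site (d + 1), w' μ t' * ∑' yw : Site (d + 1) × Site (d + 1), m yw * comp (comp (S μ t') X) (S ν (toSite rr)) yw.1 yw.2 a b :=
    fun rr => push_left_facePair hLc (hS ν (toSite rr)) hX hδ hD hS μ (w μ) (hw μ) (w' μ) (hw' μ) K (hpush μ) m hm a b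
  simp_rw [hC]
  rw [show (∑ rr ∈ box (d + 1) N, w' ν (toSite rr) * (K * ∑' t' : Site (d + 1), w' μ t' *
      ∑' yw : Site (d + 1) × Site (d + 1), m yw * comp (comp (S μ t') X) (S ν (toSite rr)) yw.1 yw.2 a b))
      = K * ∑ rr ∈ box (d + 1) N, w' ν (toSite rr) * ∑' t' : Site (d + 1), w' μ t' *
      ∑' yw : Site (d + 1) × Site (d + 1), m yw * comp (comp (S μ t') X) (S ν (toSite rr)) yw.1 yw.2 a b by
    rw [Finset.mul_sum]; exact Finset.sum_congr rfl fun rr _ => by ring]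
  -- (D) swap back at periods `(N, N)` and un-factor
  rw [← sum_box_tsum_swap_weight (P := N) (Q := N)
      (fun t' t => ∑' yw : Site (d + 1) × Site (d + 1), m yw * comp (comp (S μ t') X) (S ν t) yw.1 yw.2 a b) (w' μ) (w' ν)
      (fun t' t s => by
        show (∑' yw : Site (d + 1) × Site (d + 1), m yw * comp (comp (S μ (t' + (N : ℤ) • s)) X) (S ν (t + (N : ℤ) • s)) yw.1 yw.2 a b) = _
        rw [mixed_translate (DL := S μ) (DR := S ν) (hSt μ) (hSt ν) hXt t' t s, tsum_weightPair_shiftK m _ (hmv s)])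
      (hw'N μ) (hw'N ν)
      (fun t' => summable_word_fine (hS μ t') hX hδ hS ν (w' ν) (hw' ν) m hm a b)
      (fun t => summable_word_fine_left (hS ν t) hX hδ hS μ (w' μ) (hw' μ) m hm a b),
    sum_tsum_factor, mul_assoc]

/-! ## §3 The swapped word -/

/-- NOT IN PRINT; OUR BOOKKEEPING.  **THE SWAPPED EXCHANGE FACE WORD IS `K²` TIMES THE DEEP ONE**:
`Σ_{r′∈box P} Σ'_{u′} w μ r′·w ν u′·Σ'_{(y,w)} m·((D ν u′ ∘ X) ∘ D μ r′)(y,w)(a,b) = K·K·Σ_{rr∈box N} Σ'_t w′ μ rr·w′ ν t·Σ'_{(y,w)} m·((S ν t ∘ X) ∘ S μ rr)(y,w)(a,b)`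
— swap the cell onto `u′` (K4a at `(P, P)`), push the freed `r′` on the right, swap onto the fine bond (K4a at `(P, N)`), push `u′` on the left. -/
theorem faceWord_swap_eq (hLc : 1 ≤ Lc) (hX : Decays X CX δ) (hXt : ∀ s : Site (d + 1), shiftK (-((N : ℤ) • s)) X = X) (hδ : 0 < δ)
    (hD : ∀ κ u, BiLoc (D κ u) ((Lc : ℤ) • u) ((Lc : ℤ) • u) CD δ)
    (hDt : ∀ (κ : Fin (d + 1)) (u s : Site (d + 1)), D κ (u + (P : ℤ) • s) = shiftK (-((N : ℤ) • s)) (D κ u))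
    (hS : LocStencil S Cs δ) (hSt : ∀ (κ : Fin (d + 1)) (t s : Site (d + 1)), S κ (t + (N : ℤ) • s) = shiftK (-((N : ℤ) • s)) (S κ t))
    (w w' : Fin (d + 1) → Site (d + 1) → ℝ) (hw : ∀ κ u, |w κ u| ≤ 1) (hw' : ∀ κ t, |w' κ t| ≤ 1)
    (hwP : ∀ (κ : Fin (d + 1)) (u s : Site (d + 1)), w κ (u + (P : ℤ) • s) = w κ u)
    (hw'N : ∀ (κ : Fin (d + 1)) (t s : Site (d + 1)), w' κ (t + (N : ℤ) • s) = w' κ t) (K : ℝ)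
    (hpush : ∀ (κ : Fin (d + 1)) (x z : Site (d + 1)) (a b : Fib d),
      ∑' u : Site (d + 1), w κ u * D κ u x z a b = K * ∑' t : Site (d + 1), w' κ t * S κ t x z a b)
    (m : Site (d + 1) × Site (d + 1) → ℝ) (hm : ∀ yw, |m yw| ≤ 1)
    (hmN : ∀ (y w₀ s : Site (d + 1)), m (y + (N : ℤ) • s, w₀ + (N : ℤ) • s) = m (y, w₀)) (μ ν : Fin (d + 1)) (a b : Fib d) :
    ∑ r' ∈ box (d + 1) P, ∑' u' : Site (d + 1), w μ (toSite r') * w ν u' *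
        ∑' yw : Site (d + 1) × Site (d + 1), m yw * comp (comp (D ν u') X) (D μ (toSite r')) yw.1 yw.2 a b
      = K * K * ∑ rr ∈ box (d + 1) N, ∑' t : Site (d + 1), w' μ (toSite rr) * w' ν t *
        ∑' yw : Site (d + 1) × Site (d + 1), m yw * comp (comp (S ν t) X) (S μ (toSite rr)) yw.1 yw.2 a b := by
  have hmv : ∀ (s y w₀ : Site (d + 1)), m (y + -((N : ℤ) • s), w₀ + -((N : ℤ) • s)) = m (y, w₀) := by
    intro s y w₀
    have h := hmN y w₀ (-s)
    rwa [smul_neg] at h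
  -- (A) swap the cell from `r′` onto `u′`: periods `(P, P)` — the cell weight is `w μ`, the free weight `w ν`
  rw [sum_tsum_factor]
  rw [sum_box_tsum_swap_weight (P := P) (Q := P)
      (fun u u' => ∑' yw : Site (d + 1) × Site (d + 1), m yw * comp (comp (D ν u') X) (D μ u) yw.1 yw.2 a b) (w μ) (w ν)
      (fun u u' s => by
        show (∑' yw : Site (d + 1) × Site (d + 1), m yw * comp (comp (D ν (u' + (P : ℤ) • s)) X) (D μ (u + (P : ℤ) • s)) yw.1 yw.2 a b) = _
        rw [mixed_translate (DL := D ν) (DR := D μ) (hDt ν) (hDt μ) hXt u' u s, tsum_weightPair_shiftK m _ (hmv s)])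
      (hwP μ) (hwP ν)
      (fun u => summable_word_coarse hLc (hD μ u) hX hδ hD ν (w ν) (hw ν) m hm a b)
      (fun u' => summable_word_coarse_right hLc (hD ν u') hX hδ hD μ (w μ) (hw μ) m hm a b)]
  -- (B) push the freed `r′` (right bond of the word) in every cell term
  have hB : ∀ r' : Fin (d + 1) → ℕ, ∑' u : Site (d + 1), w μ u * ∑' yw : Site (d + 1) × Site (d + 1), m yw * comp (comp (D ν (toSite r')) X) (D μ u) yw.1 yw.2 a b
      = K * ∑' t : Site (d + 1), w' μ t * ∑' yw : Site (d + 1) × Site (d + 1), m yw * comp (comp (D ν (toSite r')) X) (S μ t) yw.1 yw.2 a b :=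
    fun r' => push_right_facePair hLc (hD ν (toSite r')) hX hδ hD hS μ (w μ) (hw μ) (w' μ) (hw' μ) K (hpush μ) m hm a b
  simp_rw [hB]
  rw [show (∑ r' ∈ box (d + 1) P, w ν (toSite r') * (K * ∑' t : Site (d + 1), w' μ t *
      ∑' yw : Site (d + 1) × Site (d + 1), m yw * comp (comp (D ν (toSite r')) X) (S μ t) yw.1 yw.2 a b))
      = K * ∑ r' ∈ box (d + 1) P, w ν (toSite r') * ∑' t : Site (d + 1), w' μ t *
      ∑' yw : Site (d + 1) × Site (d + 1), m yw * comp (comp (D ν (toSite r')) X) (S μ t) yw.1 yw.2 a b by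
    rw [Finset.mul_sum]; exact Finset.sum_congr rfl fun r' _ => by ring]
  -- (C) swap the cell from `u′` onto the fine bond `t`: periods `(P, N)`
  rw [sum_box_tsum_swap_weight (P := P) (Q := N)
      (fun u' t => ∑' yw : Site (d + 1) × Site (d + 1), m yw * comp (comp (D ν u') X) (S μ t) yw.1 yw.2 a b) (w ν) (w' μ)
      (fun u' t s => by
        show (∑' yw : Site (d + 1) × Site (d + 1), m yw * comp (comp (D ν (u' + (P : ℤ) • s)) X) (S μ (t + (N : ℤ) • s)) yw.1 yw.2 a b) = _
        rw [mixed_translate (DL := D ν) (DR := S μ) (hDt ν) (hSt μ) hXt u' t s, tsum_weightPair_shiftK m _ (hmv s)])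
      (hwP ν) (hw'N μ)
      (fun u' => summable_word_fine (hD ν u') hX hδ hS μ (w' μ) (hw' μ) m hm a b)
      (fun t => summable_word_coarse hLc (hS μ t) hX hδ hD ν (w ν) (hw ν) m hm a b)]
  -- (D) push the freed `u′` (left bond of the word) in every cell term
  have hD' : ∀ rr : Fin (d + 1) → ℕ, ∑' u' : Site (d + 1), w ν u' * ∑' yw : Site (d + 1) × Site (d + 1), m yw * comp (comp (D ν u') X) (S μ (toSite rr)) yw.1 yw.2 a b
      = K * ∑' t' : Site (d + 1), w' ν t' * ∑' yw : Site (d + 1) × Site (d + 1), m yw * comp (comp (S ν t') X) (S μ (toSite rr)) yw.1 yw.2 a b :=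
    fun rr => push_left_facePair hLc (hS μ (toSite rr)) hX hδ hD hS ν (w ν) (hw ν) (w' ν) (hw' ν) K (hpush ν) m hm a b
  simp_rw [hD']
  rw [sum_tsum_factor, Finset.mul_sum, Finset.mul_sum]
  exact Finset.sum_congr rfl fun rr _ => by ring

end Words

end Summit.QuantumFields.BalabanUV.Beta.GAN24.FaceWordsDeepCurrents

end
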